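import Summits.BirchSwinnertonDyer.BirchSwinnertonDyer.Theorems.Rank2Observatory2DescClCurveCert
import Summits.BirchSwinnertonDyer.BirchSwinnertonDyer.Theorems.Rank2Observatory2DescKill
import HarnessLib

/-!
# BirchSwinnertonDyer — rank ≥ 2 observatory: KERNEL-2DESC-CL v2.2 — the per-curve certificate with the RANK BOUND AS A PARAMETER (`checkLe r`, `rank E(ℚ) ≤ r` / `= r`)

HONEST FRAMING: per-curve certified theorems and census instruments; no claim on BSD in rank ≥ 2.

Generic addendum of the reflective class-group-general kernel 2-descent (cell `b2b-bsdr2`, seat cert-1;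
design `b2b-bsdr2-cert-1/KERNEL-2DESC-CL.md` §7.2 (2); rank-3 port spec `code/b2b-bsdr2-cert-2/v2/RANK3-V2.md`
§8). The landed per-curve checker `TwoDescCl.check fc cc` (`Rank2Observatory2DescClCurveCert`) ends in the
clause `#{admissible classes} ≤ 2²` and its soundness theorem `rank_le_two_of_check_cl` concludes
`rank E(ℚ) ≤ 2`. The descent bound is uniform in the exponent and sharp in the strict form: the admissible
classes contain the image of `E(ℚ)/2E(ℚ)`, of size `2^rank` (no rational `2`-torsion), so
`#{admissible} < 2^(r+1)` gives `rank E(ℚ) ≤ r`. This file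
* proves the strict-count class-group-general cover theorem `mordellWeilRank_le_of_coverSet_cl_lt`
  (`mordellWeilRank_le_of_coverSet_cl` of `Rank2Observatory2DescClVCover` with
  `mordellWeilRank_le_of_sqClass_cover_lt` of `Rank2Observatory2DescKill` in place of the non-strict bound);
* defines `checkLe r fc cc` = `check fc cc` with the LAST clause replaced by `card < 2 ^ (r + 1)` (every
  other clause byte-identical: model, `θ_E`, `D = F′(θ_E)`, `|N D|` factorisation against the registry,
  `D ∉ W₁, W₂`, `famCheck` of the whole family, parity certificate);
* proves `rank_le_of_checkLe_cl` (the landed soundness proof verbatim with the count generalised) and the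
  `K`-free wrappers `rank_eq_of_certsLe` / `rank_eq_of_certsLe_complSq` over `CubicField a b c` with a tree
  lower bound `r ≤ rank` (for `r = 3`: `Rank3KernelCerts<k>.C<label>.three_le_rank`; for `r = 2`:
  `KernelCerts<k>.C<label>.two_le_rank`; every sieve clause is a subgroup condition, so the admissible count is a
  power of two and `checkLe 2` accepts exactly the rows `check` accepts — the parameter matters for `r = 3`:
  `8` admissible classes ⇒ `rank ≤ 3` with no kill layer).
Shape of a sharded rank-`r` row over a field block with plumbing theorem
`rank_eq_of_curve (cc) (hc : checkLe r <field literal> cc = true) (hlow) := rank_eq_of_certsLe r _ cc (by decide +kernel) (…) hc hlow`: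
`theorem C<label>.mordellWeilRank_eq_three : (…).mordellWeilRank = 3 := <field thm> ⟨curve literal⟩ (by decide +kernel) <lower bound>`.
Kernel sanity checks at the end: the landed `4528a1` records (field `−283`, `4` admissible classes) pass
`checkLe 2` and fail `checkLe 1`.
Sorry-free; axioms `propext`, `Classical.choice`, `Quot.sound`.
[cite: Cassels1991LecturesEllipticCurves, §15] [cite: CremonaAlgorithms1997, §3.6] [cite: Cohen1993, §4.8.2, §6.5]
-/

set_option linter.dupNamespace false

noncomputable section

open scoped NumberField nonZeroDivisors

open Literature.NumberTheory.NumberFields Polynomial Module NumberField IsDedekindDomain Ideal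

namespace Summit.BirchSwinnertonDyer.BirchSwinnertonDyer.Rank2Observatory.TwoDescCl

open TwoDescCubic ClFieldCert

/-! ## The class-group-general cover theorem with a strict count -/

section CoverLt

variable {K : Type*} [Field K] [NumberField K] {n : ℕ}

/-- **Rank bound of the class-group-general 2-descent from certificates, strict-count form**: as
`mordellWeilRank_le_of_coverSet_cl`, with `#admissible pairs < 2^(s'+1) ⇒ rank E(ℚ) ≤ s'`.
[cite: Cassels1991LecturesEllipticCurves, §15] -/
theorem mordellWeilRank_le_of_coverSet_cl_lt {A B C : ℤ}
    (E : WeierstrassCurve ℚ) [E.IsElliptic] (ha₁ : E.a₁ = 0) (ha₂ : E.a₂ = A) (ha₃ : E.a₃ = 0)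
    (ha₄ : E.a₄ = B) (ha₆ : E.a₆ = C) (hirr : Irreducible (MonicCubic.polyQ A B C)) {θ : 𝓞 K}
    (hθ : aeval (algebraMap (𝓞 K) K θ) (MonicCubic.poly A B C) = 0) (h3 : finrank ℚ K = 3)
    {M : 𝓞 K} (hM : M ≠ 0)
    (hgen : Subgroup.closure {c : ClassGroup (𝓞 K) | ∃ (J : Ideal (𝓞 K))
      (hJ : J ∈ (Ideal (𝓞 K))⁰), M ∈ J ∧ ClassGroup.mk0 ⟨J, hJ⟩ = c} = ⊤)
    (hDM : ∀ v : HeightOneSpectrum (𝓞 K),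
      (3 : 𝓞 K) * θ ^ 2 + 2 * (A : 𝓞 K) * θ + (B : 𝓞 K) ∈ v.asIdeal → M ∈ v.asIdeal)
    {W : Fin n → 𝓞 K} (hW0 : ∀ j, W j ≠ 0)
    (hW : ∀ u : K, u ≠ 0 →
      (∀ v : HeightOneSpectrum (𝓞 K), M ∉ v.asIdeal → v.valuation K u = 1) →
      ∃ U : Finset (Fin n), IsSquare (u * ∏ j ∈ U, algebraMap (𝓞 K) K (W j)))
    {Wu : Fin 0 → (𝓞 K)ˣ} {adm : Finset (Fin 0) → Finset (Fin n) → Bool} (h0 : adm ∅ ∅ = true)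
    (hadm : ∀ x y : ℚ, y ^ 2 = x ^ 3 + A * x ^ 2 + B * x + C →
      ∀ (T : Finset (Fin 0)) (U : Finset (Fin n)),
        IsSquare ((algebraMap ℚ K x - algebraMap (𝓞 K) K θ) *
          (∏ i ∈ T, algebraMap (𝓞 K) K (Wu i)) * ∏ j ∈ U, algebraMap (𝓞 K) K (W j)) →
        adm T U = true)
    {s' : ℕ} (hcard : ((Finset.univ ×ˢ Finset.univ).filter
      (fun p : Finset (Fin 0) × Finset (Fin n) => adm p.1 p.2 = true)).card < 2 ^ (s' + 1)) :
    E.mordellWeilRank ≤ s' := by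
  classical
  have hrootK := MonicCubic.theta_rel hθ
  have hF : θ ^ 3 + A * θ ^ 2 + B * θ + C = 0 := by
    apply RingOfIntegers.coe_injective
    simpa only [map_add, map_mul, map_pow, map_intCast, _root_.map_zero] using hrootK
  have hroot : (algebraMap (𝓞 K) K θ) ^ 3 + algebraMap ℚ K E.a₂ * (algebraMap (𝓞 K) K θ) ^ 2 +
      algebraMap ℚ K E.a₄ * algebraMap (𝓞 K) K θ + algebraMap ℚ K E.a₆ = 0 := by
    rw [ha₂, ha₄, ha₆]
    simpa only [map_intCast] using hrootK
  have hlin := powIndep_algebraMap hirr hθ h3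
  have hspan := exists_coords hirr hθ h3
  have hθQ : ∀ q : ℚ, algebraMap ℚ K q ≠ algebraMap (𝓞 K) K θ := ne_of_powIndep hlin
  refine mordellWeilRank_le_of_sqClass_cover_lt E (algebraMap ℚ K) ha₁ ha₃ hroot hlin hspan
    (coverSet Wu W adm) (one_mem_coverSet Wu W h0) ?_ ((card_coverSet_le Wu W adm).trans_lt hcard)
  intro x y hxy
  have hE : y ^ 2 = x ^ 3 + A * x ^ 2 + B * x + C := by
    have h := hxy.left
    rw [WeierstrassCurve.Affine.equation_iff] at h
    have e₁ : E.toAffine.a₁ = 0 := ha₁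
    have e₂ : E.toAffine.a₂ = A := ha₂
    have e₃ : E.toAffine.a₃ = 0 := ha₃
    have e₄ : E.toAffine.a₄ = B := ha₄
    have e₆ : E.toAffine.a₆ = C := ha₆
    rw [e₁, e₂, e₃, e₄, e₆] at h
    linear_combination h
  exact sqClass_mem_coverSet_cl hF hθQ hM hgen hDM hW0 hW hadm hE

end CoverLt

/-! ## The `r`-checker -/

/-- **The per-curve checker with the rank bound as a parameter**: the clauses of `check fc cc` (`Δ ≠ 0`; `F`
has no root mod `pF`; `F(t) = 0`, `F′(t) = D`; `Δ(F) < 0`; `N D ≠ 0` and `|N D| = ∏ p^e` against registry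
rows; the codes of `supp D`; `D ∉ W₁, W₂`; `Q > 0`; `famCheck` of the whole family; the parity
certificate) and, last, FEWER THAN `2^(r+1)` admissible classes. Computable; run by `decide +kernel`.
[cite: Cassels1991LecturesEllipticCurves, §15] [cite: CremonaAlgorithms1997, §3.6] -/
def checkLe (r : ℕ) (fc : ClFieldCert) (cc : ClCurveCert) : Bool :=
  decide (deltaShort cc.A cc.B cc.C ≠ 0) &&
    noRootMod cc.pF cc.A cc.B cc.C &&
    decide (cubicAtCoords fc.a fc.b fc.c cc.A cc.B cc.C cc.t = (0, 0, 0)) &&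
    decide (derivAtCoords fc.a fc.b fc.c cc.A cc.B cc.t =
      MonicCubic.mulCoords fc.a fc.b fc.c cc.D (prodPowCoords fc.a fc.b fc.c [])) &&
    decide (MonicCubic.disc cc.A cc.B cc.C < 0) &&
    decide (normFormZ fc.a fc.b fc.c cc.D.1 cc.D.2.1 cc.D.2.2 ≠ 0) &&
    decide ((normFormZ fc.a fc.b fc.c cc.D.1 cc.D.2.1 cc.D.2.2).natAbs = (cc.dn.map fun pe => pe.1 ^ pe.2).prod) &&
    (cc.dn.all fun pe => (fc.primes.any fun e => e.p == pe.1) &&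
      ((fc.row pe.1).codes.all fun C' => decide (C' ∈ cc.codes) ||
        cc.dinv.any fun ci => ci.1 == C' && invCert fc.a fc.b fc.c C' cc.D ci.2)) &&
    (cc.codes.all fun C => (fc.primes.any fun e => e.p == C.1) && decide (C ∈ (fc.row C.1).codes)) &&
    invCert fc.a fc.b fc.c fc.w₁ cc.D cc.dW1 && invCert fc.a fc.b fc.c fc.w₂ cc.D cc.dW2 &&
    (cc.Q.all fun q => decide (0 < q)) &&
    ((fam fc cc).all fun f => famCheck fc cc.D f) &&
    decide (∀ T : Finset (Fin (fam fc cc).length), T ≠ ∅ →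
      ∃ k : Fin (fc.chars.length + 3), Odd (T.filter fun j => bit fc cc k j = true).card) &&
    decide (((Finset.univ ×ˢ Finset.univ).filter
      (fun p : Finset (Fin 0) × Finset (Fin (fam fc cc).length) => adm fc cc p.1 p.2 = true)).card <
        2 ^ (r + 1))

/-! ## Soundness -/

section Sound

variable {K : Type*} [Field K] [NumberField K] {θ : K}

/-- **Soundness of the `r`-checker: `rank E(ℚ) ≤ r`** (the proof of `rank_le_two_of_check_cl` with the count
generalised). [cite: Cassels1991LecturesEllipticCurves, §15] -/
theorem rank_le_of_checkLe_cl (r : ℕ) (fc : ClFieldCert) (hθ : aeval θ (MonicCubic.poly fc.a fc.b fc.c) = 0)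
    (h3 : finrank ℚ K = 3) (hF : fc.check = true) (hpr : fc.primeList.Forall Nat.Prime) (cc : ClCurveCert)
    (hc : checkLe r fc cc = true) : ((⟨0, cc.A, 0, cc.B, cc.C⟩ : WeierstrassCurve ℚ)).mordellWeilRank ≤ r := by
  classical
  have hirr := fc.irreducible_of_check hF
  have hq := fc.q_prime hpr
  simp only [checkLe, Bool.and_eq_true, decide_eq_true_eq, List.all_eq_true, List.any_eq_true,
    Bool.or_eq_true, beq_iff_eq] at hc
  obtain ⟨⟨⟨⟨⟨⟨⟨⟨⟨⟨⟨⟨⟨⟨hΔ, hirrF⟩, hcub⟩, hder⟩, hdisc⟩, hND0⟩, hdn⟩, hdnC⟩, hcodes⟩, hdW1⟩, hdW2⟩, hQ⟩,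
    hfamAll⟩, hcert⟩, hcount⟩ := hc
  haveI hE := isElliptic_of_deltaShort_ne hΔ
  have hirrF' := irreducible_of_noRootMod hirrF
  -- `θ_E`, `D`, `M = D·q`
  have haev := aeval_lin_eq_zero_of_coords hθ cc.t hcub
  have hderiv : (3 : 𝓞 K) * (lin hθ cc.t.1 cc.t.2.1 cc.t.2.2) ^ 2 +
      2 * ((cc.A : ℤ) : 𝓞 K) * (lin hθ cc.t.1 cc.t.2.1 cc.t.2.2) + ((cc.B : ℤ) : 𝓞 K) =
        lin hθ cc.D.1 cc.D.2.1 cc.D.2.2 := by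
    simpa using deriv_eq_of_coords hθ cc.t cc.D [] hder
  have hD0 : (lin hθ cc.D.1 cc.D.2.1 cc.D.2.2 : 𝓞 K) ≠ 0 := lin_ne_zero_of_coords hirr hθ h3 _ hND0
  have hq0 : ((fc.q : ℕ) : 𝓞 K) ≠ 0 := by exact_mod_cast hq.ne_zero
  have hM0 : (lin hθ cc.D.1 cc.D.2.1 cc.D.2.2 : 𝓞 K) * ((fc.q : ℕ) : 𝓞 K) ≠ 0 := mul_ne_zero hD0 hq0
  have hgen := closure_tsupp_eq_top_of_dvd
    (dvd_mul_left ((fc.q : ℕ) : 𝓞 K) (lin hθ cc.D.1 cc.D.2.1 cc.D.2.2)) (fc.closure_q_eq_top_of_check hθ h3 hF hpr)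
  have hDM : ∀ v : HeightOneSpectrum (𝓞 K), (3 : 𝓞 K) * (lin hθ cc.t.1 cc.t.2.1 cc.t.2.2) ^ 2 +
      2 * ((cc.A : ℤ) : 𝓞 K) * (lin hθ cc.t.1 cc.t.2.1 cc.t.2.2) + ((cc.B : ℤ) : 𝓞 K) ∈ v.asIdeal →
      (lin hθ cc.D.1 cc.D.2.1 cc.D.2.2 : 𝓞 K) * ((fc.q : ℕ) : 𝓞 K) ∈ v.asIdeal := by
    intro v hv
    rw [hderiv] at hv
    exact Ideal.mul_mem_right _ _ hv
  have hDW₁ : (lin hθ cc.D.1 cc.D.2.1 cc.D.2.2 : 𝓞 K) ∉ (fc.W₁ hθ h3 hF hpr).asIdeal :=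
    lin_not_mem_of_invCert hθ _ (W₁_asIdeal hθ h3 hF hpr) hdW1
  have hDW₂ : (lin hθ cc.D.1 cc.D.2.1 cc.D.2.2 : 𝓞 K) ∉ (fc.W₂ hθ h3 hF hpr).asIdeal :=
    lin_not_mem_of_invCert hθ _ (W₂_asIdeal hθ h3 hF hpr) hdW2
  -- the support `T = {W₁, W₂} ∪ codes`
  set L := cc.codes.length with hL
  let Tf : Fin (L + 2) → HeightOneSpectrum (𝓞 K) := Matrix.vecCons (fc.W₁ hθ h3 hF hpr)
    (Matrix.vecCons (fc.W₂ hθ h3 hF hpr) fun i => codePrime hθ h3 hF hpr (cc.codes.get i))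
  have hT : ∀ w : HeightOneSpectrum (𝓞 K),
      (lin hθ cc.D.1 cc.D.2.1 cc.D.2.2 : 𝓞 K) * ((fc.q : ℕ) : 𝓞 K) ∈ w.asIdeal → ∃ i, Tf i = w := by
    intro w hw
    rcases w.isPrime.mem_or_mem hw with hD | hqw
    · obtain ⟨l, hl, hldvd, hlw⟩ := exists_prime_dvd_norm_mem w hD0 hD
      rw [natAbs_norm_lin_coords hirr hθ h3, hdn] at hldvd
      obtain ⟨a, ha, hla⟩ := (Prime.dvd_prod_iff hl.prime).mp hldvd
      obtain ⟨pe, hpe, rfl⟩ := List.mem_map.mp ha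
      obtain ⟨hany, hrowcodes⟩ := hdnC pe hpe
      have hany' : (fc.primes.any fun e => e.p == pe.1) = true := by simpa [List.any_eq_true] using hany
      obtain ⟨hrow, hrowp⟩ := row_mem hany'
      have hpp : (fc.row pe.1).p.Prime := fc.prime_of_mem hpr hrow
      have hl_eq : l = pe.1 :=
        (Nat.prime_dvd_prime_iff_eq hl (hrowp ▸ hpp)).mp (hl.dvd_of_dvd_pow hla)
      have hlw' : ((fc.row pe.1).p : 𝓞 K) ∈ w.asIdeal := by rw [hrowp, ← hl_eq]; exact hlw
      obtain ⟨C', hC', hw'⟩ :=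
        exists_code_of_natCast_mem hirr hθ h3 hpp (fc.row_check_of_mem hF hrow).1 w hlw'
      rcases hrowcodes C' hC' with hmem | ⟨ci, -, hci, hinv⟩
      · obtain ⟨i, hi⟩ := List.mem_iff_get.mp hmem
        obtain ⟨hc1, hc2⟩ := hcodes _ (List.get_mem _ i)
        have hc1' : (fc.primes.any fun e => e.p == (cc.codes.get i).1) = true := by
          simpa [List.any_eq_true] using hc1
        refine ⟨i.succ.succ, HeightOneSpectrum.ext ?_⟩
        simp only [Tf, Matrix.cons_val_succ]
        rw [codePrime_asIdeal hθ h3 hF hpr hc1' hc2, hi, hw']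
      · exact absurd hD (lin_not_mem_of_invCert hθ w hw' hinv)
    · rcases eq_W₁_or_W₂ hθ h3 hF hpr w hqw with rfl | rfl
      · exact ⟨0, by simp [Tf]⟩
      · exact ⟨1, by simp [Tf]⟩
  -- the family
  set fm := fam fc cc with hfm
  let W : Fin fm.length → 𝓞 K := fun j => lin hθ (fm.get j).2.2.g.1 (fm.get j).2.2.g.2.1 (fm.get j).2.2.g.2.2
  have hfam : ∀ j : Fin fm.length, famCheck fc cc.D (fm.get j) = true := fun j => hfamAll _ (List.get_mem _ j)
  have hW0 : ∀ j, W j ≠ 0 := fun j => lin_ne_zero_of_famCheck hθ h3 hF (hfam j)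
  have hWval : ∀ j (v : HeightOneSpectrum (𝓞 K)),
      (lin hθ cc.D.1 cc.D.2.1 cc.D.2.2 : 𝓞 K) * ((fc.q : ℕ) : 𝓞 K) ∉ v.asIdeal →
        v.valuation K (algebraMap (𝓞 K) K (W j)) = 1 :=
    fun j v hv => valuation_eq_one_of_support _ _ (supp_of_famCheck hθ h3 hF hpr (hfam j)) v hv
  obtain ⟨ρ, hlo, hhi⟩ := fc.exists_rho_of_check hθ h3 hF
  -- independence modulo squares: the parity certificate
  have hind : ∀ S : Finset (Fin fm.length), IsSquare (∏ i ∈ S, algebraMap (𝓞 K) K (W i)) → S = ∅ := by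
    intro S hS
    refine indep_of_parity_certificate (fun i => algebraMap (𝓞 K) K (W i)) (bit fc cc) ?_ hcert S hS
    intro k S' hS'
    have hS'' : IsSquare (∏ i ∈ S', W i) := isSquare_prod_of_isSquare_prod_coe _ hS'
    obtain ⟨k, hk⟩ := k
    rcases k with _ | _ | _ | k
    · have h := even_card_of_isSquare_real ρ (fun i => algebraMap (𝓞 K) K (W i))
        (fun i => rho_ne_zero_of_famCheck hθ ρ hlo hhi hF (hfam i)) hS'
      convert h using 2
      refine Finset.filter_congr (fun i _ => ?_)
      exact sign_iff_of_famCheck hθ ρ hlo hhi hF (hfam i)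
    · exact even_card_of_isSquare_valuation (fc.W₁ hθ h3 hF hpr) W hW0 _
        (fun i => by
          show ((!decide ((2 : ℤ) ∣ famL₁ (fm.get i))) = true ↔ _)
          rw [log_W₁_of_famCheck hθ h3 hF hpr (hfam i)]; simp) hS'
    · exact even_card_of_isSquare_valuation (fc.W₂ hθ h3 hF hpr) W hW0 _
        (fun i => by
          show ((!decide ((2 : ℤ) ∣ famL₂ (fm.get i))) = true ↔ _)
          rw [log_W₂_of_famCheck hθ h3 hF hpr (hfam i)]; simp) hS'
    · have hk' : k < fc.chars.length := by omega
      have hch : fc.chars.getD k ((3 : ℕ), (0 : ℤ), (0 : ℤ)) ∈ fc.chars := by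
        rw [List.getD_eq_getElem?_getD, List.getElem?_eq_getElem hk', Option.getD_some]
        exact List.getElem_mem hk'
      obtain ⟨h2, ψ, hψ⟩ := fc.exists_psi_of_check hθ h3 hF hpr hch
      haveI : Fact (fc.chars.getD k (3, 0, 0)).1.Prime := ⟨fc.char_prime hpr hch⟩
      have h := even_card_filter_eulerBit hθ (ℓ := (fc.chars.getD k (3, 0, 0)).1) (by omega) ψ hψ
        (fun i => (fm.get i).2.2.g) (fun i => not_dvd_evalInt_of_famCheck (hfam i) hch) hS''
      convert h using 2
      exact Finset.filter_congr (fun i _ => Iff.rfl)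
  -- spanning of the `T`-units modulo squares
  have hodd : Odd (finrank ℚ K) := by rw [h3]; decide
  have hn : fm.length = NumberField.Units.rank K + 1 + (L + 2) := by
    rw [fc.units_rank_of_check hθ h3 hF]
    simp only [hfm, fam, List.length_cons, List.length_map, hL]
    omega
  have hspan : ∀ u : K, u ≠ 0 →
      (∀ v : HeightOneSpectrum (𝓞 K),
        (lin hθ cc.D.1 cc.D.2.1 cc.D.2.2 : 𝓞 K) * ((fc.q : ℕ) : 𝓞 K) ∉ v.asIdeal → v.valuation K u = 1) →
      ∃ U : Finset (Fin fm.length), IsSquare (u * ∏ j ∈ U, algebraMap (𝓞 K) K (W j)) :=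
    fun u hu huT => exists_isSquare_tunit_mul_prod hodd _ Tf hT hn (fun j => algebraMap (𝓞 K) K (W j))
      (fun j => RingOfIntegers.coe_ne_zero_iff.mpr (hW0 j)) hWval hind u hu huT
  -- the sieve is sound at rational points
  have hθQ : ∀ x : ℚ, algebraMap ℚ K x ≠ algebraMap (𝓞 K) K (lin hθ cc.t.1 cc.t.2.1 cc.t.2.2) :=
    ne_of_powIndep (powIndep_algebraMap hirrF' haev h3)
  have hFrel : (lin hθ cc.t.1 cc.t.2.1 cc.t.2.2 : 𝓞 K) ^ 3 + cc.A * (lin hθ cc.t.1 cc.t.2.1 cc.t.2.2) ^ 2 +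
      cc.B * (lin hθ cc.t.1 cc.t.2.1 cc.t.2.2) + cc.C = 0 := by
    apply RingOfIntegers.coe_injective
    simpa only [map_add, map_mul, map_pow, map_intCast, _root_.map_zero] using MonicCubic.theta_rel haev
  have hadm0 : adm fc cc ∅ ∅ = true := by
    simp only [adm, Bool.and_eq_true, decide_eq_true_eq, Finset.filter_empty, Finset.card_empty]
    exact ⟨⟨admStdQ_empty _ hQ _ _ _ _, by decide⟩, by decide⟩
  have hadm : ∀ x y : ℚ, y ^ 2 = x ^ 3 + cc.A * x ^ 2 + cc.B * x + cc.C →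
      ∀ (T : Finset (Fin 0)) (U : Finset (Fin fm.length)),
        IsSquare ((algebraMap ℚ K x - algebraMap (𝓞 K) K (lin hθ cc.t.1 cc.t.2.1 cc.t.2.2)) *
          (∏ i ∈ T, algebraMap (𝓞 K) K (((fun i : Fin 0 => i.elim0 : Fin 0 → (𝓞 K)ˣ) i : (𝓞 K)ˣ) : 𝓞 K)) *
            ∏ j ∈ U, algebraMap (𝓞 K) K (W j)) → adm fc cc T U = true := by
    intro x y hxy T U hsq
    have hcof := cofactor_pos_of_disc_neg (rho_theta_root ρ haev) hdisc
    have h1 : admStd (fun i : Fin 0 => i.elim0) (famNorm fc cc) (fun i : Fin 0 => i.elim0) (famSign fc cc) T U =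
        true :=
      admStd_sound hirrF' haev h3 ρ hcof (w := fun i : Fin 0 => algebraMap (𝓞 K) K
          (((fun i : Fin 0 => i.elim0 : Fin 0 → (𝓞 K)ˣ) i : (𝓞 K)ˣ) : 𝓞 K))
        (g := fun j => algebraMap (𝓞 K) K (W j)) (fun i => i.elim0)
        (fun j => RingOfIntegers.coe_ne_zero_iff.mpr (hW0 j)) (fun i => i.elim0)
        (fun j => norm_of_famCheck hθ h3 hF) (fun i => i.elim0)
        (fun j => sign_iff_of_famCheck hθ ρ hlo hhi hF (hfam j)) x y hxy T U hsq
    have h2 := valRow_sound hFrel hθQ (fc.W₁ hθ h3 hF hpr) (by rw [hderiv]; exact hDW₁) hW0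
      (r := fun j => bitRow fc (fm.get j) 1) (fun j => by
        show ((!decide ((2 : ℤ) ∣ famL₁ (fm.get j))) = true ↔ _)
        rw [show algebraMap (𝓞 K) K (W j) = ((W j : 𝓞 K) : K) from rfl,
          log_W₁_of_famCheck hθ h3 hF hpr (hfam j)]; simp) x y hxy T U hsq
    have h3' := valRow_sound hFrel hθQ (fc.W₂ hθ h3 hF hpr) (by rw [hderiv]; exact hDW₂) hW0
      (r := fun j => bitRow fc (fm.get j) 2) (fun j => by
        show ((!decide ((2 : ℤ) ∣ famL₂ (fm.get j))) = true ↔ _)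
        rw [show algebraMap (𝓞 K) K (W j) = ((W j : 𝓞 K) : K) from rfl,
          log_W₂_of_famCheck hθ h3 hF hpr (hfam j)]; simp) x y hxy T U hsq
    simp only [adm, Bool.and_eq_true]
    exact ⟨⟨admStdQ_of_admStd hQ h1, h2⟩, h3'⟩
  exact mordellWeilRank_le_of_coverSet_cl_lt (A := cc.A) (B := cc.B) (C := cc.C)
    (⟨0, cc.A, 0, cc.B, cc.C⟩ : WeierstrassCurve ℚ) rfl rfl rfl rfl rfl hirrF' haev h3 hM0 hgen hDM hW0 hspan
    (Wu := fun i : Fin 0 => i.elim0) (adm := adm fc cc) hadm0 hadm (s' := r) hcount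

/-- **`rank E(ℚ) = r`** from checked field and `r`-checked curve records and a tree lower bound `r ≤ rank`.
[cite: CremonaAlgorithms1997, §3.6] -/
theorem rank_eq_of_checkLe_cl (r : ℕ) (fc : ClFieldCert) (hθ : aeval θ (MonicCubic.poly fc.a fc.b fc.c) = 0)
    (h3 : finrank ℚ K = 3) (hF : fc.check = true) (hpr : fc.primeList.Forall Nat.Prime) (cc : ClCurveCert)
    (hc : checkLe r fc cc = true)
    (hlow : r ≤ (((⟨0, cc.A, 0, cc.B, cc.C⟩ : WeierstrassCurve ℤ)).map (Int.castRingHom ℚ)).mordellWeilRank) :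
    (((⟨0, cc.A, 0, cc.B, cc.C⟩ : WeierstrassCurve ℤ)).map (Int.castRingHom ℚ)).mordellWeilRank = r := by
  have hE : ((⟨0, cc.A, 0, cc.B, cc.C⟩ : WeierstrassCurve ℤ)).map (Int.castRingHom ℚ) =
      (⟨0, cc.A, 0, cc.B, cc.C⟩ : WeierstrassCurve ℚ) := by
    ext <;> simp [WeierstrassCurve.map]
  refine le_antisymm ?_ hlow
  rw [hE]
  exact rank_le_of_checkLe_cl r fc hθ h3 hF hpr cc hc

end Sound

/-! ## `K`-free wrappers over the model `CubicField a b c` (the shape of every sharded rank-`r` row) -/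

/-- **`rank E(ℚ) = r` from the two records** (model `(0, A, 0, B, C)`):
`rank_eq_of_certsLe r <field> ⟨curve⟩ (by decide +kernel) (by norm_num [ClFieldCert.primeList]) (by decide +kernel) <lower bound>`.
[cite: Cassels1991LecturesEllipticCurves, §15] [cite: CremonaAlgorithms1997, §3.6] -/
theorem rank_eq_of_certsLe (r : ℕ) (fc : ClFieldCert) (cc : ClCurveCert) (hF : fc.check = true)
    (hpr : fc.primeList.Forall Nat.Prime) (hc : checkLe r fc cc = true)
    (hlow : r ≤ (((⟨0, cc.A, 0, cc.B, cc.C⟩ : WeierstrassCurve ℤ)).map (Int.castRingHom ℚ)).mordellWeilRank) :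
    (((⟨0, cc.A, 0, cc.B, cc.C⟩ : WeierstrassCurve ℤ)).map (Int.castRingHom ℚ)).mordellWeilRank = r := by
  haveI : Fact (Irreducible (MonicCubic.polyQ fc.a fc.b fc.c)) := ⟨fc.irreducible_of_check hF⟩
  exact rank_eq_of_checkLe_cl (K := CubicField fc.a fc.b fc.c) r fc (CubicField.aeval_root fc.a fc.b fc.c)
    (CubicField.finrank_eq fc.a fc.b fc.c) hF hpr cc hc hlow

/-- **`rank E(ℚ) = r` for the ORIGINAL model** `(a₁, a₂, a₃, a₄, a₆)` when the records certify its
completed-square model `(0, a₁² + 4a₂, 0, 8(a₁a₃ + 2a₄), 16(a₃² + 4a₆))` (rank is invariant under the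
variable change). [cite: CremonaAlgorithms1997, §3.6] -/
theorem rank_eq_of_certsLe_complSq (r : ℕ) (fc : ClFieldCert) (cc : ClCurveCert) (hF : fc.check = true)
    (hpr : fc.primeList.Forall Nat.Prime) (hc : checkLe r fc cc = true) (a₁ a₂ a₃ a₄ a₆ : ℤ)
    (hABC : cc.A = a₁ ^ 2 + 4 * a₂ ∧ cc.B = 8 * (a₁ * a₃ + 2 * a₄) ∧ cc.C = 16 * (a₃ ^ 2 + 4 * a₆))
    (hlow : r ≤ (((⟨a₁, a₂, a₃, a₄, a₆⟩ : WeierstrassCurve ℤ)).map (Int.castRingHom ℚ)).mordellWeilRank) :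
    (((⟨a₁, a₂, a₃, a₄, a₆⟩ : WeierstrassCurve ℤ)).map (Int.castRingHom ℚ)).mordellWeilRank = r := by
  obtain ⟨hA, hB, hC⟩ := hABC
  have hV : ((⟨0, cc.A, 0, cc.B, cc.C⟩ : WeierstrassCurve ℤ)).map (Int.castRingHom ℚ) =
      (⟨Units.mk0 (1 / 2 : ℚ) (by norm_num), 0, -(a₁ : ℚ) / 2, -(a₃ : ℚ) / 2⟩ :
        WeierstrassCurve.VariableChange ℚ) •
        (((⟨a₁, a₂, a₃, a₄, a₆⟩ : WeierstrassCurve ℤ)).map (Int.castRingHom ℚ)) := by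
    ext <;> simp only [WeierstrassCurve.map_a₁, WeierstrassCurve.map_a₂, WeierstrassCurve.map_a₃,
      WeierstrassCurve.map_a₄, WeierstrassCurve.map_a₆, WeierstrassCurve.variableChange_a₁,
      WeierstrassCurve.variableChange_a₂, WeierstrassCurve.variableChange_a₃,
      WeierstrassCurve.variableChange_a₄, WeierstrassCurve.variableChange_a₆, Units.val_inv_eq_inv_val,
      Units.val_mk0, hA, hB, hC, eq_intCast, Int.cast_zero] <;> push_cast <;> ring
  have hr : (((⟨0, cc.A, 0, cc.B, cc.C⟩ : WeierstrassCurve ℤ)).map (Int.castRingHom ℚ)).mordellWeilRank =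
      (((⟨a₁, a₂, a₃, a₄, a₆⟩ : WeierstrassCurve ℤ)).map (Int.castRingHom ℚ)).mordellWeilRank := by
    rw [hV]; exact WeierstrassCurve.mordellWeilRank_variableChange_holds _ _
  rw [← hr] at hlow ⊢
  exact rank_eq_of_certsLe r fc cc hF hpr hc hlow

/-! ## Kernel sanity checks on landed records (`4528a1` over the field `−283`: `4` admissible classes) -/

/-- The landed field record of discriminant `−283` (kernel sanity check only). -/
private def m283t : ClFieldCert :=
  ⟨0, 4, -1, 7, 123/500, 247/1000, 5, 19, (3, 3, 13), (2, 0, 0), [(3, 2, 1), (5, 2, 2), (31, 24, 8)],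
    ⟨(0, 0, 0), (-4, 0, -1), true, (0, -1, 0), 0, 0, (0, 0, 0), []⟩,
    ⟨(0, 0, 0), (10, 0, 1), false, (36, 1, -6), 2, 2, (-9, 6, -3), []⟩,
    [⟨2, 1, (1, 1, 1), (0, 2, 0), [(3, -1, 0, 1), (7, 1, 1, 1)],
       [⟨(1, 1, 1), (7, 1, 1), false, (6, -3, -1), 1, 1, (0, -8, 0), [(1, 0, 0)]⟩]⟩,
     ⟨3, 1, (2, 2, 2), (1, 2, 0), [(1, 0, 2, 1)], []⟩,
     ⟨283, 0, (248, 248, 70), (15213, -340, 2), [],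
       [⟨(-248, 1, 0), (-4, 0, -3), true, (-1216, -171, -456), 1, 0, (9, -3, 0), [(118, 0, 0)]⟩]⟩]⟩

/-- The landed `4528a1` curve record over `m283t` (kernel sanity check only). -/
private def c4528a1t : ClCurveCert :=
  ⟨1, -4, 12, 7, (-3, -1, -1), (23, -5, 7), [(2, 4), (283, 1)], [(2, 1, 1, 1), (283, -248, 1, 0)],
    [((2, -1, 1, 0), (1, 0, 0)), ((283, -70, 1, 0), (196, 0, 0))], (15, 0, 0), (17, 10, 0), [8]⟩

example : check m283t c4528a1t = true := by decide +kernel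

example : checkLe 2 m283t c4528a1t = true := by decide +kernel

example : checkLe 1 m283t c4528a1t = false := by decide +kernel

end Summit.BirchSwinnertonDyer.BirchSwinnertonDyer.Rank2Observatory.TwoDescCl

end
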